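import Summits.Ventures.HodgeRepro2.T5SU11BetaExp
import Summits.Ventures.HodgeRepro2.T5SU11CoeffPowCartan

/-!
# The Iwasawa-coordinate evaluation of `∫_G (1 − |g·0|²)^{k/2} e^{λ t(g)} dν(g)`

The function `F_{k,λ}(g) = (1 − |g·0|²)^{k/2} e^{λ t(g)}` (`t` the Iwasawa `A`-projection) is
right-`K`-invariant, so by `ν = (mulBK)_*(borelHaar ⊗ μ_K)` (`T5SU11HaarBK`) and
`borelHaar = ((s, t) ↦ a_t n_s)_*(ds dt)` (`T5SU11BorelHaarNA`) its `ν`-integral is the plane integral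
of `F_{k,λ}(a_t n_s)`. On `a_t n_s` the matrix entry is `a(a_t n_s) = cosh t + i s e^{t}`
(`T5SU11BorelSubgroup.normSq_mat_hyp_mul_unip`), so `1 − |a_t n_s · 0|² = (cosh² t + s² e^{2t})⁻¹`
(`one_sub_norm_orbit_sq_hyp_mul_unip`), while `t(a_t n_s) = t` (`iwasawaT_hyp_mul_unip`). Fubini on
`ℝ²` then reduces the integral to the horocycle integral and the exponential Beta integral of
`T5SU11BetaExp`:
**`∫_G (1 − |g·0|²)^{k/2} e^{λ t(g)} dν = 2^{k−2} √π Γ((k−1)/2)/Γ(k/2) · Γ((k−λ)/2) Γ((k+λ)/2 − 1)/Γ(k−1)`**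
for `k > 1`, `λ < k`, `k + λ > 2` (`integral_orbit_rpow_mul_exp_iwasawaT`), with the integrability of
`F_{k,λ}` (`integrable_orbit_rpow_mul_exp_iwasawaT`). At `λ = 0` this is
`∫_G (1 − |g·0|²)^{k/2} dν = 2π/(k − 2)` (`integral_orbit_rpow_nu`, via Legendre's duplication
formula), which for `k = 2m` is the formal-degree integral `π/(m − 1)` of `T5SU11CoeffPowCartan`
(`iwasawa_eq_disc_pow`). Nothing is claimed about (N).

Blind lane: Mathlib + the HodgeRepro2 prefix only; no sorry; axioms ⊆ {propext, Classical.choice,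
Quot.sound}.
-/

namespace Summit.Ventures.HodgeRepro2.T5SU11JacobiIwasawa

open MeasureTheory MeasureTheory.Measure Metric Set Filter Topology Complex
open T5SU11Unimodular T5SU11Fibration T5SU11Cartan T5SU11OneParameter T5SU11CartanProjection
  T5HaarCircle T5BergmanCoefficient T5SU11FibrationHaar T5SU11UnipotentSubgroup
  T5SU11BorelSubgroup T5SU11BorelHaar T5SU11BorelHaarNA T5SU11HaarBK T5SU11IwasawaProjection
  T5SU11CoeffSqCartan T5SU11SphericalFunction T5SU11BetaImproper T5SU11BetaExp
open scoped Real

/-! ### The integrand on `a_t n_s` -/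

/-- `1 − |a_t n_s · 0|² = (cosh² t + s² e^{2t})⁻¹`. -/
lemma one_sub_norm_orbit_sq_hyp_mul_unip (t s : ℝ) :
    1 - ‖orbit (hyp t * unip s)‖ ^ 2 = (Real.cosh t ^ 2 + s ^ 2 * Real.exp (2 * t))⁻¹ := by
  rw [one_sub_norm_orbit_sq, inv_pow, Complex.sq_norm, normSq_mat_hyp_mul_unip]

/-- `t(a_t n_s) = t`. -/
lemma iwasawaT_hyp_mul_unip (t s : ℝ) : iwasawaT (hyp t * unip s) = t := by
  rw [iwasawaT_hyp_mul, ← mul_one (unip s), iwasawaT_unip_mul, iwasawaT_one, zero_add]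

/-- `(1 − |a_t n_s · 0|²)^{k/2} = (cosh² t + s² e^{2t})^{-k/2}`. -/
lemma one_sub_norm_orbit_sq_rpow_hyp_mul_unip (k t s : ℝ) :
    (1 - ‖orbit (hyp t * unip s)‖ ^ 2) ^ (k / 2)
      = (Real.cosh t ^ 2 + s ^ 2 * Real.exp (2 * t)) ^ (-(k / 2)) := by
  rw [one_sub_norm_orbit_sq_hyp_mul_unip, Real.inv_rpow (by positivity), Real.rpow_neg (by positivity)]

/-- The coordinate `mulAN (s, t)` is `a_t n_s`. -/
lemma coe_mulAN (p : ℝ × ℝ) : ((mulAN p : borelSubgroup) : SU11) = hyp p.2 * unip p.1 := rfl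

/-- The plane integrand `G_{k,λ}(s, t) = (cosh² t + s² e^{2t})^{-k/2} e^{λ t}` is continuous. -/
lemma continuous_planeIntegrand (k lam : ℝ) :
    Continuous fun p : ℝ × ℝ =>
      (Real.cosh p.2 ^ 2 + p.1 ^ 2 * Real.exp (2 * p.2)) ^ (-(k / 2)) * Real.exp (lam * p.2) := by
  have h1 : Continuous fun p : ℝ × ℝ => Real.cosh p.2 ^ 2 + p.1 ^ 2 * Real.exp (2 * p.2) := by
    fun_prop
  refine (h1.rpow_const fun p => Or.inl ?_).mul (by fun_prop)
  have := Real.cosh_pos p.2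
  positivity

/-- `F_{k,λ}(g · rot u) = F_{k,λ}(g)`: right-`K`-invariance. -/
lemma orbit_rpow_mul_exp_iwasawaT_mul_rot (k lam : ℝ) (g : SU11) (u : Circle) :
    (1 - ‖orbit (g * rot u)‖ ^ 2) ^ (k / 2) * Real.exp (lam * iwasawaT (g * rot u))
      = (1 - ‖orbit g‖ ^ 2) ^ (k / 2) * Real.exp (lam * iwasawaT g) := by
  rw [orbit_mul_rot, iwasawaT_mul_rot]

/-- **`∫_B F_{k,λ}(b) db = ∫_{ℝ²} (cosh² t + s² e^{2t})^{-k/2} e^{λ t} ds dt`** — hypothesis-free. -/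
theorem integral_borel_orbit_rpow_mul_exp_iwasawaT (k lam : ℝ) :
    ∫ b, (1 - ‖orbit (b : SU11)‖ ^ 2) ^ (k / 2) * Real.exp (lam * iwasawaT (b : SU11)) ∂borelHaar
      = ∫ p : ℝ × ℝ,
          (Real.cosh p.2 ^ 2 + p.1 ^ 2 * Real.exp (2 * p.2)) ^ (-(k / 2)) * Real.exp (lam * p.2) := by
  rw [integral_borelHaar_prod]
  congr 1
  funext p
  rw [coe_mulAN, one_sub_norm_orbit_sq_rpow_hyp_mul_unip, iwasawaT_hyp_mul_unip]

/-- The pointwise identity behind the cross-check: `(1 − |g·0|²)^{2m/2} = coeffPow m g`. -/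
lemma orbit_rpow_eq_coeffPow (m : ℕ) (g : SU11) :
    (1 - ‖orbit g‖ ^ 2) ^ ((2 * (m : ℝ)) / 2) = T5SU11CoeffPowCartan.coeffPow m g := by
  rw [T5SU11CoeffPowCartan.coeffPow, show (2 * (m : ℝ)) / 2 = (m : ℝ) by ring, Real.rpow_natCast]

/-- The plane integrand is integrable on `ℝ²` for `k > 1`, `λ < k`, `k + λ > 2`. -/
theorem integrable_planeIntegrand {k lam : ℝ} (hk : 1 < k) (h1 : lam < k) (h2 : 2 < k + lam) :
    Integrable (fun p : ℝ × ℝ =>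
      (Real.cosh p.2 ^ 2 + p.1 ^ 2 * Real.exp (2 * p.2)) ^ (-(k / 2)) * Real.exp (lam * p.2))
      ((volume : Measure ℝ).prod volume) := by
  refine (integrable_prod_iff' (continuous_planeIntegrand k lam).aestronglyMeasurable).mpr
    ⟨Filter.Eventually.of_forall fun t => ?_, ?_⟩
  · show Integrable (fun s : ℝ =>
      (Real.cosh t ^ 2 + s ^ 2 * Real.exp (2 * t)) ^ (-(k / 2)) * Real.exp (lam * t)) volume
    exact (integrable_cosh_sq_add_sq_mul_exp_rpow hk t).mul_const _
  · show Integrable (fun t : ℝ => ∫ s : ℝ,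
      ‖(Real.cosh t ^ 2 + s ^ 2 * Real.exp (2 * t)) ^ (-(k / 2)) * Real.exp (lam * t)‖) volume
    have e : (fun t : ℝ => ∫ s : ℝ,
        ‖(Real.cosh t ^ 2 + s ^ 2 * Real.exp (2 * t)) ^ (-(k / 2)) * Real.exp (lam * t)‖)
        = fun t : ℝ => Real.exp (lam * t) * (2 ^ (k - 1) * Real.exp (-k * t)
          * (1 + Real.exp (-2 * t)) ^ (1 - k)
          * (√π * Real.Gamma ((k - 1) / 2) / Real.Gamma (k / 2))) := by
      funext t
      have hpt : ∀ s : ℝ,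
          ‖(Real.cosh t ^ 2 + s ^ 2 * Real.exp (2 * t)) ^ (-(k / 2)) * Real.exp (lam * t)‖
          = (Real.cosh t ^ 2 + s ^ 2 * Real.exp (2 * t)) ^ (-(k / 2)) * Real.exp (lam * t) := by
        intro s
        rw [Real.norm_eq_abs, abs_of_nonneg (by positivity)]
      simp_rw [hpt]
      rw [integral_mul_const, integral_cosh_sq_add_sq_mul_exp_rpow hk t, mul_comm]
    rw [e]
    exact integrable_exp_mul_horocycle hk h1 h2

/-- **Legendre's duplication at `(k − 2)/2`**: `Γ((k−2)/2) Γ((k−1)/2) = 2^{3−k} √π Γ(k − 2)`. -/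
lemma gamma_duplication_weight (k : ℝ) :
    Real.Gamma ((k - 2) / 2) * Real.Gamma ((k - 1) / 2) = 2 ^ (3 - k) * √π * Real.Gamma (k - 2) := by
  have h := Real.Gamma_mul_Gamma_add_half ((k - 2) / 2)
  rw [show (k - 2) / 2 + 1 / 2 = (k - 1) / 2 by ring, show 2 * ((k - 2) / 2) = k - 2 by ring,
    show 1 - (k - 2) = 3 - k by ring] at h
  rw [h]
  ring

/-! ### The integrability and the evaluation -/

section measure

variable [MeasurableSpace Circle] [BorelSpace Circle]

/-- **`∫_G F_{k,λ} dν = ∫_B F_{k,λ}(b) db`** for the right-`K`-invariant `F_{k,λ}` (`ν = db dk`,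
`μ_K` a probability measure) — hypothesis-free. -/
theorem integral_orbit_rpow_mul_exp_iwasawaT_eq_borel (k lam : ℝ) :
    ∫ g, (1 - ‖orbit g‖ ^ 2) ^ (k / 2) * Real.exp (lam * iwasawaT g) ∂(nu haarCircle)
      = ∫ b, (1 - ‖orbit (b : SU11)‖ ^ 2) ^ (k / 2) * Real.exp (lam * iwasawaT (b : SU11))
          ∂borelHaar := by
  rw [integral_nu_mulBK]
  have e : (fun p : borelSubgroup × Circle =>
      (1 - ‖orbit (mulBK p)‖ ^ 2) ^ (k / 2) * Real.exp (lam * iwasawaT (mulBK p)))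
      = fun p => ((1 - ‖orbit (p.1 : SU11)‖ ^ 2) ^ (k / 2) * Real.exp (lam * iwasawaT (p.1 : SU11)))
          * (1 : ℝ) := by
    funext p
    rw [mul_one, mulBK_apply, orbit_rpow_mul_exp_iwasawaT_mul_rot]
  have h := integral_prod_mul (μ := borelHaar) (ν := haarCircle)
    (fun b : borelSubgroup => (1 - ‖orbit (b : SU11)‖ ^ 2) ^ (k / 2) * Real.exp (lam * iwasawaT (b : SU11)))
    (fun _ : Circle => (1 : ℝ))
  beta_reduce at h
  rw [e, h, integral_const, measureReal_def, haarCircle_univ, ENNReal.toReal_one, one_smul, mul_one]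

/-- **THE IWASAWA-COORDINATE EVALUATION**: for `k > 1`, `λ < k`, `k + λ > 2`,
`∫_G (1 − |g·0|²)^{k/2} e^{λ t(g)} dν = 2^{k−2} √π Γ((k−1)/2)/Γ(k/2) · Γ((k−λ)/2) Γ((k+λ)/2 − 1)/Γ(k−1)`. -/
theorem integral_orbit_rpow_mul_exp_iwasawaT {k lam : ℝ} (hk : 1 < k) (h1 : lam < k)
    (h2 : 2 < k + lam) :
    ∫ g, (1 - ‖orbit g‖ ^ 2) ^ (k / 2) * Real.exp (lam * iwasawaT g) ∂(nu haarCircle)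
      = 2 ^ (k - 2) * (√π * Real.Gamma ((k - 1) / 2) / Real.Gamma (k / 2))
          * (Real.Gamma ((k - lam) / 2) * Real.Gamma ((k + lam) / 2 - 1) / Real.Gamma (k - 1)) := by
  rw [integral_orbit_rpow_mul_exp_iwasawaT_eq_borel, integral_borel_orbit_rpow_mul_exp_iwasawaT,
    volume_eq_prod, integral_prod_symm _ (integrable_planeIntegrand hk h1 h2)]
  have e : ∀ t : ℝ, ∫ s : ℝ,
      (Real.cosh t ^ 2 + s ^ 2 * Real.exp (2 * t)) ^ (-(k / 2)) * Real.exp (lam * t)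
      = Real.exp (lam * t) * (2 ^ (k - 1) * Real.exp (-k * t) * (1 + Real.exp (-2 * t)) ^ (1 - k)
          * (√π * Real.Gamma ((k - 1) / 2) / Real.Gamma (k / 2))) := by
    intro t
    rw [integral_mul_const, integral_cosh_sq_add_sq_mul_exp_rpow hk t, mul_comm]
  simp_rw [e]
  exact integral_exp_mul_horocycle hk h1 h2

/-- `F_{k,λ}` is `ν`-integrable for `k > 1`, `λ < k`, `k + λ > 2` (a posteriori). -/
theorem integrable_orbit_rpow_mul_exp_iwasawaT {k lam : ℝ} (hk : 1 < k) (h1 : lam < k)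
    (h2 : 2 < k + lam) :
    Integrable (fun g => (1 - ‖orbit g‖ ^ 2) ^ (k / 2) * Real.exp (lam * iwasawaT g))
      (nu haarCircle) := by
  by_contra h
  have h0 := integral_undef h
  rw [integral_orbit_rpow_mul_exp_iwasawaT hk h1 h2] at h0
  have g1 : 0 < Real.Gamma ((k - 1) / 2) := Real.Gamma_pos_of_pos (by linarith)
  have g2 : 0 < Real.Gamma (k / 2) := Real.Gamma_pos_of_pos (by linarith)
  have g3 : 0 < Real.Gamma ((k - lam) / 2) := Real.Gamma_pos_of_pos (by linarith)
  have g4 : 0 < Real.Gamma ((k + lam) / 2 - 1) := Real.Gamma_pos_of_pos (by linarith)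
  have g5 : 0 < Real.Gamma (k - 1) := Real.Gamma_pos_of_pos (by linarith)
  have g6 : (0 : ℝ) < 2 ^ (k - 2) := Real.rpow_pos_of_pos (by norm_num) _
  have : 0 < 2 ^ (k - 2) * (√π * Real.Gamma ((k - 1) / 2) / Real.Gamma (k / 2))
      * (Real.Gamma ((k - lam) / 2) * Real.Gamma ((k + lam) / 2 - 1) / Real.Gamma (k - 1)) := by
    positivity
  linarith

/-! ### The case `λ = 0`: the formal-degree integral `2π/(k − 2)` -/

/-- **`∫_G (1 − |g·0|²)^{k/2} dν = 2π/(k − 2)`** for `k > 2` (the value of the Iwasawa-coordinate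
evaluation at `λ = 0`, simplified by Legendre's duplication formula). -/
theorem integral_orbit_rpow_nu {k : ℝ} (hk : 2 < k) :
    ∫ g, (1 - ‖orbit g‖ ^ 2) ^ (k / 2) ∂(nu haarCircle) = 2 * π / (k - 2) := by
  have h := integral_orbit_rpow_mul_exp_iwasawaT (lam := 0) (by linarith) (by linarith) (by linarith)
  simp only [zero_mul, Real.exp_zero, mul_one, sub_zero, add_zero] at h
  rw [h, show k / 2 - 1 = (k - 2) / 2 by ring]
  have hπ : 0 < π := Real.pi_pos
  have hs : 0 < √π := Real.sqrt_pos.mpr hπ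
  have hsq : √π * √π = π := Real.mul_self_sqrt hπ.le
  have g1 : 0 < Real.Gamma ((k - 1) / 2) := Real.Gamma_pos_of_pos (by linarith)
  have g2 : 0 < Real.Gamma (k / 2) := Real.Gamma_pos_of_pos (by linarith)
  have g3 : 0 < Real.Gamma (k - 1) := Real.Gamma_pos_of_pos (by linarith)
  have g4 : 0 < Real.Gamma (k - 2) := Real.Gamma_pos_of_pos (by linarith)
  have hrec : Real.Gamma (k - 1) = (k - 2) * Real.Gamma (k - 2) := by
    rw [show k - 1 = (k - 2) + 1 by ring, Real.Gamma_add_one (by linarith)]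
  have hdup := gamma_duplication_weight k
  have h2 : (2 : ℝ) ^ (k - 2) * 2 ^ (3 - k) = 2 := by
    rw [← Real.rpow_add (by norm_num), show k - 2 + (3 - k) = 1 by ring, Real.rpow_one]
  rw [hrec]
  have key : 2 ^ (k - 2) * (√π * Real.Gamma ((k - 1) / 2) / Real.Gamma (k / 2))
      * (Real.Gamma (k / 2) * Real.Gamma ((k - 2) / 2) / ((k - 2) * Real.Gamma (k - 2)))
      = 2 ^ (k - 2) * √π * (Real.Gamma ((k - 2) / 2) * Real.Gamma ((k - 1) / 2))
        / ((k - 2) * Real.Gamma (k - 2)) := by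
    field_simp
  rw [key, hdup, div_eq_div_iff (by positivity) (by linarith)]
  linear_combination ((k - 2) * Real.Gamma (k - 2) * (√π * √π)) * h2
    + (2 * (k - 2) * Real.Gamma (k - 2)) * hsq

/-- **The even weights**: `∫_G (1 − |g·0|²)^{m} dν = π/(m − 1)` for `m ≥ 2` from the Iwasawa-coordinate
evaluation at `k = 2m` (`(1 − |g·0|²)^{2m/2} = (1 − |g·0|²)^m`). -/
theorem integral_orbit_rpow_nu_nat {m : ℕ} (hm : 2 ≤ m) :
    ∫ g, (1 - ‖orbit g‖ ^ 2) ^ ((2 * (m : ℝ)) / 2) ∂(nu haarCircle) = π / ((m : ℝ) - 1) := by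
  have hm' : (2 : ℝ) ≤ m := by exact_mod_cast hm
  rw [integral_orbit_rpow_nu (k := 2 * (m : ℝ)) (by linarith), show 2 * (m : ℝ) - 2 = 2 * (m - 1) by ring,
    mul_div_mul_left _ _ (by norm_num)]

/-- **Cross-check with the disc / Cartan computations of `T5SU11CoeffPowCartan`**: the Iwasawa-coordinate
value of `∫_G (1 − |g·0|²)^m dν` agrees with `integral_coeffPow_nu` (`π/(m − 1)`), for every `m ≥ 2`. -/
theorem iwasawa_eq_disc_pow {m : ℕ} (hm : 2 ≤ m) :
    ∫ g, (1 - ‖orbit g‖ ^ 2) ^ ((2 * (m : ℝ)) / 2) ∂(nu haarCircle)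
      = ∫ g, T5SU11CoeffPowCartan.coeffPow m g ∂(nu haarCircle) := by
  rw [integral_orbit_rpow_nu_nat hm, T5SU11CoeffPowCartan.integral_coeffPow_nu hm]

end measure

end Summit.Ventures.HodgeRepro2.T5SU11JacobiIwasawa
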